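import Literature.Algebra.EuclideanLattices.PQCLLL
import Literature.Algebra.EuclideanLattices.LLLProofs
import HarnessLib

/-!
# Discharge of LLL82 Prop. 1.12 (and Prop. 1.11, (1.10)–(1.11)): `‖bⱼ‖² ≤ 2^{n-1} λᵢ₊₁(L)²`,
# and of Prop. 1.6 (1.8)–(1.9): `∏ᵢ ‖bᵢ‖ ≤ 2^{n(n-1)/4} d(L)`, `‖b₀‖ ≤ 2^{(n-1)/4} d(L)^{1/n}`

Family PQC / trunk T-LATTICE; sibling **proof file** of
`Literature.Algebra.EuclideanLattices.PQCLLL` (pqc.S15), no definitions. It discharges the named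
facts

* `Literature.Algebra.EuclideanLattices.IsLLLReduced.norm_sq_le_two_pow_mul_successiveMinimum_sq` (LLL82 Prop. 1.12) as
  `norm_sq_le_two_pow_mul_successiveMinimum_sq_holds`,
* `Literature.Algebra.EuclideanLattices.IsLLLReduced.norm_zero_sq_le_two_pow_mul_minNorm_sq` (LLL82 Prop. 1.11) as
  `norm_zero_sq_le_two_pow_mul_minNorm_sq_holds` (the case `i = j = 0` of Prop. 1.12 together
  with `λ₁ = minNorm`, `Literature.Algebra.EuclideanLattices.successiveMinimum_one_eq_minNorm_holds`),

* `Literature.Algebra.EuclideanLattices.IsLLLReduced.prod_norm_le` (LLL82 Prop. 1.6 (1.8)) as `prod_norm_le_holds` and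
  `Literature.Algebra.EuclideanLattices.IsLLLReduced.norm_zero_le_covolume_rpow` (LLL82 Prop. 1.6 (1.9)) as
  `norm_zero_le_covolume_rpow_holds` (last section of this file, via the volume formula
  `d(L) = ∏ᵢ ‖b*ᵢ‖`, `Literature.Algebra.EuclideanLattices.covolume_latticeOfBasis_eq_prod_norm_gramSchmidt`),

for an LLL-reduced (`δ = 3/4`) basis `b : Basis (Fin n) ℝ E` of a real inner product space and
the lattice `L = Literature.PQC.latticeOfBasis b = ∑ᵢ ℤ bᵢ`; the key estimate rests on the **top-index
inequality** `Literature.Algebra.EuclideanLattices.norm_gramSchmidt_le_norm_sum_smul` (LLL82 (1.10)–(1.11)) proved here.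
The Prop. 1.6 estimate (1.7) (`‖bⱼ‖² ≤ 2^i ‖b*ᵢ‖²` for `j ≤ i`) and the discharge
`Literature.Algebra.EuclideanLattices.minNorm_span_ge_iInf_norm_gramSchmidt_holds` of the fact
`Literature.Algebra.EuclideanLattices.minNorm_span_ge_iInf_norm_gramSchmidt` of `Literature.Algebra.EuclideanLattices.LLL`
(`minᵢ ‖b*ᵢ‖ ≤ λ₁(∑ ℤ bᵢ)`) are taken from `Literature.Algebra.EuclideanLattices.LLLProofs`
(`Literature.Algebra.EuclideanLattices.IsLLLReduced.sq_norm_le_two_pow_mul_holds`,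
`Literature.Algebra.EuclideanLattices.minNorm_span_ge_iInf_norm_gramSchmidt_holds`; the latter was formerly duplicated in
this file and is no longer redeclared here).

Proof of Prop. 1.12 (LLL82 §1; Cohen, GTM 138, Thm. 2.6.2 (5), whose proof "is proved by a
generalization of the present argument [for (4)] and is left to the reader"; Lenstra, *Lattices*,
§10, Proposition "Successive minima and c-reduced bases", lower bound `c^{1-n} q(bᵢ) ≤ λᵢ(L)` with
`c = 2`). Let `r ≥ 0` be such that the lattice vectors of norm `≤ r` span a subspace of dimension
`≥ i + 1` (the set of such `r` has infimum `λᵢ₊₁(L)` by definition of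
`Literature.Algebra.EuclideanLattices.successiveMinimum`, and is nonempty since `r = ∑ₖ ‖bₖ‖` belongs to it). The vectors
`bₖ`, `k < j`, span a subspace `W` of dimension `≤ j < i + 1`, so some `x ∈ L` with `‖x‖ ≤ r` is
not in `W`; writing `x = ∑ rₖ bₖ` (`rₖ ∈ ℤ`) and letting `i₀` be the largest index with
`rᵢ₀ ≠ 0`, we get `i₀ ≥ j`, whence by (1.7) and the top-index inequality (1.10)–(1.11)
(`⟪x, b*ᵢ₀⟫ = rᵢ₀ ‖b*ᵢ₀‖²`, `|rᵢ₀| ≥ 1`, so `‖b*ᵢ₀‖ ≤ ‖x‖`):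
`‖bⱼ‖² ≤ 2^{i₀} ‖b*ᵢ₀‖² ≤ 2^{n-1} ‖x‖² ≤ 2^{n-1} r²`. Taking the infimum over `r` gives the
claim. (LLL82 orders `t` independent vectors by their top indices `i(1) ≤ … ≤ i(t)` and observes
`j ≤ i(j)`; the dimension count above is that observation for the single index `j`.) No
discreteness or attainment of the minimum is needed.

Proof of Prop. 1.6 (1.8)–(1.9) (LLL82 §1, proof of (1.6); Cohen, GTM 138, Thm. 2.6.2 (1), (3) and
its proof, p. 132, with the volume formula Prop. 2.5.4, pp. 128–129, `d(L)² = ∏ ‖b*ᵢ‖²`, where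
`d(L) = det(bᵢ ⋅ bⱼ)^{1/2} = |det B|`, §2.5.1 p. 127). The Gram–Schmidt form
`∏ ‖bᵢ‖ ≤ 2^{n(n-1)/4} ∏ ‖b*ᵢ‖` of (1.8) and the estimate `‖b₀‖² ≤ 2^i ‖b*ᵢ‖²` are taken from
`Literature.Algebra.EuclideanLattices.LLLProofs`
(`prod_norm_le_two_pow_mul_prod_norm_gramSchmidt_holds`, `sq_norm_zero_le_two_pow_mul_holds`).
The remaining ingredient is `d(L) = ∏ᵢ ‖b*ᵢ‖` for `d(L) = ZLattice.covolume L` with respect to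
the canonical volume of the inner product space (`measureSpaceOfInnerProductSpace`, giving an
orthonormal parallelepiped mass `1`), proved in
`Literature.Algebra.EuclideanLattices.covolume_latticeOfBasis_eq_prod_norm_gramSchmidt`: by
`ZLattice.covolume_eq_measure_fundamentalDomain` and `ZSpan.measureReal_fundamentalDomain`
(change of basis to the orthonormal basis `e = gramSchmidtOrthonormalBasis` of Mathlib),
`d(L) = |det_e(b)| · vol(fundamental domain of e)`; the second factor is `1`
(`OrthonormalBasis.volume_parallelepiped`), and `det_e(b) = ∏ᵢ ⟪eᵢ, bᵢ⟫`
(`gramSchmidtOrthonormalBasis_det`, triangularity) with `eᵢ = b*ᵢ/‖b*ᵢ‖` and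
`⟪bᵢ, b*ᵢ⟫ = ‖b*ᵢ‖²` (`Literature.Algebra.EuclideanLattices.inner_self_gramSchmidt`), i.e. `⟪eᵢ, bᵢ⟫ = ‖b*ᵢ‖`. Then
(1.8) is the Gram–Schmidt form rewritten, and (1.9) follows from `‖b₀‖² ≤ 2^i ‖b*ᵢ‖²` for all
`i` by taking the product over `i`: `‖b₀‖^{2n} ≤ 2^{n(n-1)/2} d(L)²`, and `2n`-th roots
(Cohen, proof of Thm. 2.6.2 (3)).

## References

* A. K. Lenstra, H. W. Lenstra Jr., L. Lovász, *Factoring polynomials with rational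
  coefficients*, Math. Ann. 261 (1982) 515–534, doi:10.1007/BF01457454, Prop. 1.6 (1.8)–(1.9),
  (1.10)–(1.11), Prop. 1.11, Prop. 1.12. [LenstraLenstraLovasz1982] (primary; the paper itself is
  not held — acquisition request filed — statements cross-checked against the two held
  expositions below).
* H. Cohen, *A Course in Computational Algebraic Number Theory*, GTM 138, Springer 1993,
  §2.5.1 p. 127 (`d(L)`), Prop. 2.5.4 (pp. 128–129), Def. 2.6.1, Thm. 2.6.2 (1), (3), (4)–(5)
  and proof, pp. 131–132. [Cohen1993]
* H. W. Lenstra Jr., *Lattices*, in: J. P. Buhler, P. Stevenhagen (eds.), *Algorithmic Number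
  Theory*, MSRI Publ. 44, Cambridge Univ. Press 2008, 127–181, §10 "Flags" (Proposition on
  successive minima and `c`-reduced bases; the shortest-vector paragraph). [Lenstra2008Lattices]
-/

noncomputable section

open Finset Module InnerProductSpace Metric
open scoped RealInnerProductSpace

namespace Literature.Algebra.EuclideanLattices

/-! ### The top-index inequality, LLL82 (1.10)–(1.11) -/

section General

variable {E : Type*} [NormedAddCommGroup E] [InnerProductSpace ℝ E]
variable {ι : Type*} [LinearOrder ι] [LocallyFiniteOrderBot ι] [WellFoundedLT ι]

/-- **Top-index inequality** (LLL82 (1.10)–(1.11); Cohen, GTM 138, proof of Thm. 2.6.2 (4)): if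
`b` is linearly independent and `x = ∑ⱼ rⱼ bⱼ` with integer coefficients, `rᵢ ≠ 0` and `rⱼ = 0`
for all `j > i`, then `‖b*ᵢ‖ ≤ ‖x‖`. Indeed `⟪x, b*ᵢ⟫ = rᵢ ‖b*ᵢ‖²` (the `bⱼ`, `j < i`, are
orthogonal to `b*ᵢ`), so `|rᵢ| ‖b*ᵢ‖ ≤ ‖x‖` by Cauchy–Schwarz, and `|rᵢ| ≥ 1`.
[cite: LenstraLenstraLovasz1982, (1.10)–(1.11)] -/
theorem norm_gramSchmidt_le_norm_sum_smul [Fintype ι] {b : ι → E} (hb : LinearIndependent ℝ b)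
    (r : ι → ℤ) {i : ι} (hi : r i ≠ 0) (hr : ∀ j, i < j → r j = 0) :
    ‖gramSchmidt ℝ b i‖ ≤ ‖∑ j, r j • b j‖ := by
  set x := ∑ j, r j • b j with hx
  have hinner : ⟪x, gramSchmidt ℝ b i⟫_ℝ = (r i : ℝ) * ‖gramSchmidt ℝ b i‖ ^ 2 := by
    rw [hx, sum_inner, Finset.sum_eq_single i]
    · rw [← Int.cast_smul_eq_zsmul ℝ, real_inner_smul_left, inner_self_gramSchmidt]
    · intro j _ hji
      rcases lt_or_gt_of_ne hji with hlt | hgt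
      · rw [← Int.cast_smul_eq_zsmul ℝ, real_inner_smul_left, real_inner_comm,
          gramSchmidt_inv_triangular ℝ b hlt, mul_zero]
      · rw [hr j hgt, zero_smul, inner_zero_left]
    · intro h
      exact absurd (Finset.mem_univ i) h
  have hpos : 0 < ‖gramSchmidt ℝ b i‖ := norm_pos_iff.2 (gramSchmidt_ne_zero i hb)
  have h1 : (1 : ℝ) ≤ |(r i : ℝ)| := by exact_mod_cast Int.one_le_abs hi
  have hcs := abs_real_inner_le_norm x (gramSchmidt ℝ b i)
  rw [hinner, abs_mul, abs_of_nonneg (sq_nonneg ‖gramSchmidt ℝ b i‖)] at hcs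
  have h2 : |(r i : ℝ)| * ‖gramSchmidt ℝ b i‖ ≤ ‖x‖ :=
    le_of_mul_le_mul_right (by rw [mul_assoc, ← sq]; exact hcs) hpos
  calc ‖gramSchmidt ℝ b i‖ = 1 * ‖gramSchmidt ℝ b i‖ := (one_mul _).symm
    _ ≤ |(r i : ℝ)| * ‖gramSchmidt ℝ b i‖ := mul_le_mul_of_nonneg_right h1 hpos.le
    _ ≤ ‖x‖ := h2

end General

end Literature.Algebra.EuclideanLattices

/-! ### LLL82 Prop. 1.12 and Prop. 1.11 -/

namespace Literature.Algebra.EuclideanLattices.IsLLLReduced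

variable {E : Type*} [NormedAddCommGroup E] [InnerProductSpace ℝ E] {n : ℕ}

/-- **LLL82 Prop. 1.12, key estimate.** If `b` is an LLL-reduced (`δ = 3/4`) basis of `E`,
`L = ∑ ℤ bₖ`, `j ≤ i`, and `r` is such that the vectors of `L` of norm at most `r` span a
subspace of dimension at least `i + 1`, then `‖bⱼ‖² ≤ 2^{n-1} r²`. (The printed proof, for `r` the
maximum norm of `i + 1` linearly independent lattice vectors.) Ref: LLL82, proof of Prop. 1.12;
Cohen, GTM 138, Thm. 2.6.2 (5). [cite: LenstraLenstraLovasz1982, Prop. 1.12] -/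
theorem norm_sq_le_two_pow_mul_sq_of_le_finrank (b : Basis (Fin n) ℝ E)
    (h : IsLLLReduced (3 / 4) ⇑b) {i j : Fin n} (hji : j ≤ i) {r : ℝ}
    (hfin : (i : ℕ) + 1 ≤ finrank ℝ (Submodule.span ℝ
      ((Literature.Computability.Cryptography.latticeOfBasis b : Set E) ∩ closedBall (0 : E) r))) :
    ‖b j‖ ^ 2 ≤ 2 ^ (n - 1) * r ^ 2 := by
  classical
  haveI : FiniteDimensional ℝ E := Module.Finite.of_basis b
  -- the subspace spanned by `b k`, `k < j`, has dimension `≤ j`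
  set W : Submodule ℝ E := Submodule.span ℝ (((Iio j).image ⇑b : Finset E) : Set E) with hW
  have hWj : finrank ℝ W ≤ (j : ℕ) :=
    (finrank_span_finset_le_card _).trans (Finset.card_image_le.trans (Fin.card_Iio j).le)
  -- hence some lattice vector of norm `≤ r` lies outside `W`
  have hnot : ¬ ((Literature.Computability.Cryptography.latticeOfBasis b : Set E) ∩ closedBall (0 : E) r ⊆ (W : Set E)) := by
    intro hsub
    have h1 : Submodule.span ℝ ((Literature.Computability.Cryptography.latticeOfBasis b : Set E) ∩ closedBall (0 : E) r) ≤ W :=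
      Submodule.span_le.2 hsub
    have h2 := Submodule.finrank_mono h1
    have h3 : (j : ℕ) ≤ i := hji
    omega
  obtain ⟨x, ⟨hxL, hxr⟩, hxW⟩ := Set.not_subset.1 hnot
  rw [mem_closedBall_zero_iff] at hxr
  -- write `x = ∑ c k • b k` with integer coefficients and let `i₀` be the top index
  obtain ⟨c, rfl⟩ := (Submodule.mem_span_range_iff_exists_fun ℤ).1 hxL
  have hT : (Finset.univ.filter fun k => c k ≠ 0).Nonempty := by
    by_contra hT
    rw [Finset.not_nonempty_iff_eq_empty, Finset.filter_eq_empty_iff] at hT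
    apply hxW
    rw [Finset.sum_eq_zero fun k _ => by rw [not_not.1 (hT (Finset.mem_univ k)), zero_smul]]
    exact W.zero_mem
  set i₀ := (Finset.univ.filter fun k => c k ≠ 0).max' hT with hi₀_def
  have hi₀ : c i₀ ≠ 0 := (Finset.mem_filter.1 (Finset.max'_mem _ hT)).2
  have htop : ∀ k, i₀ < k → c k = 0 := by
    intro k hk
    by_contra hck
    exact absurd (Finset.le_max' _ k (Finset.mem_filter.2 ⟨Finset.mem_univ _, hck⟩)) (not_le.2 hk)
  -- `j ≤ i₀`: otherwise every `b k` with `c k ≠ 0` has `k < j`, so `x ∈ W`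
  have hji₀ : j ≤ i₀ := by
    by_contra hlt
    push Not at hlt
    apply hxW
    refine Submodule.sum_mem _ fun k _ => ?_
    by_cases hck : c k = 0
    · rw [hck, zero_smul]
      exact W.zero_mem
    · have hk : k < j := by
        by_contra hkj
        push Not at hkj
        exact hck (htop k (lt_of_lt_of_le hlt hkj))
      exact zsmul_mem (Submodule.subset_span (by
        rw [Finset.coe_image]
        exact Set.mem_image_of_mem _ (by simpa using hk))) _
  -- assemble: (1.7), the top-index inequality, `‖x‖ ≤ r`, `2^{i₀} ≤ 2^{n-1}`
  have h17 := sq_norm_le_two_pow_mul_holds h hji₀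
  have htopineq := norm_gramSchmidt_le_norm_sum_smul b.linearIndependent c hi₀ htop
  have hpow : (2 : ℝ) ^ (i₀ : ℕ) ≤ 2 ^ (n - 1) :=
    pow_le_pow_right₀ one_le_two (by have := i₀.isLt; omega)
  have hx2 : ‖gramSchmidt ℝ (⇑b) i₀‖ ^ 2 ≤ r ^ 2 :=
    pow_le_pow_left₀ (norm_nonneg _) (htopineq.trans hxr) 2
  calc ‖b j‖ ^ 2 ≤ 2 ^ (i₀ : ℕ) * ‖gramSchmidt ℝ (⇑b) i₀‖ ^ 2 := h17
    _ ≤ 2 ^ (n - 1) * r ^ 2 := mul_le_mul hpow hx2 (sq_nonneg _) (by positivity)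

/-- **Discharge of LLL82 Prop. 1.12** (`norm_sq_le_two_pow_mul_successiveMinimum_sq`): for an
LLL-reduced (`δ = 3/4`) basis `b₀, …, bₙ₋₁` of `E` and `L = ∑ ℤ bₖ`,
`‖bⱼ‖² ≤ 2^{n-1} λᵢ₊₁(L)²` for `j ≤ i < n` (0-indexed). The set of radii whose infimum defines
`λᵢ₊₁(L)` (`Literature.Algebra.EuclideanLattices.successiveMinimum`) contains `∑ₖ ‖bₖ‖` and, by
`norm_sq_le_two_pow_mul_sq_of_le_finrank`, only radii `r` with `‖bⱼ‖ / 2^{(n-1)/2} ≤ r`.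
Ref: LLL82, Prop. 1.12; Cohen, GTM 138, Thm. 2.6.2 (5); Lenstra, *Lattices*, §10, Proposition
(`c^{1-n} q(bᵢ) ≤ λᵢ(L)`, `c = 2`). [cite: LenstraLenstraLovasz1982, Prop. 1.12] -/
theorem norm_sq_le_two_pow_mul_successiveMinimum_sq_holds :
    norm_sq_le_two_pow_mul_successiveMinimum_sq (E := E) (n := n) := by
  intro b h i j hji
  haveI : FiniteDimensional ℝ E := Module.Finite.of_basis b
  set L := Literature.Computability.Cryptography.latticeOfBasis b with hL
  -- the set of radii whose infimum is `λ_{i+1}(L)`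
  set S : Set ℝ := {r : ℝ | 0 ≤ r ∧
    (i : ℕ) + 1 ≤ finrank ℝ (Submodule.span ℝ ((L : Set E) ∩ closedBall (0 : E) r))} with hS
  have hdef : successiveMinimum L ((i : ℕ) + 1) = sInf S := rfl
  -- `S` is nonempty: `R = ∑ ‖b k‖` works
  have hR : (∑ k, ‖b k‖) ∈ S := by
    refine ⟨Finset.sum_nonneg fun k _ => norm_nonneg _, ?_⟩
    have htop : Submodule.span ℝ ((L : Set E) ∩ closedBall (0 : E) (∑ k, ‖b k‖)) = ⊤ := by
      refine eq_top_iff.2 (b.span_eq.ge.trans (Submodule.span_mono ?_))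
      rintro _ ⟨k, rfl⟩
      refine ⟨Submodule.subset_span (Set.mem_range_self k), ?_⟩
      rw [mem_closedBall_zero_iff]
      exact Finset.single_le_sum (fun k _ => norm_nonneg (b k)) (Finset.mem_univ k)
    rw [htop, finrank_top, finrank_eq_card_basis b, Fintype.card_fin]
    exact i.isLt
  -- every `r ∈ S` satisfies `‖b j‖² / 2^{n-1} ≤ r²`, i.e. `c₀ ≤ r` with `c₀ = √(‖b j‖² / 2^{n-1})`
  set c₀ : ℝ := Real.sqrt (‖b j‖ ^ 2 / 2 ^ (n - 1)) with hc₀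
  have hpos : (0 : ℝ) < 2 ^ (n - 1) := by positivity
  have hc₀S : ∀ r ∈ S, c₀ ≤ r := by
    rintro r ⟨hr0, hr⟩
    have hkey := norm_sq_le_two_pow_mul_sq_of_le_finrank b h hji hr
    have : ‖b j‖ ^ 2 / 2 ^ (n - 1) ≤ r ^ 2 := by
      rw [div_le_iff₀ hpos]
      linarith
    calc c₀ ≤ Real.sqrt (r ^ 2) := Real.sqrt_le_sqrt this
      _ = r := Real.sqrt_sq hr0
  have hle : c₀ ≤ sInf S := le_csInf ⟨_, hR⟩ hc₀S
  have hc₀nn : 0 ≤ c₀ := Real.sqrt_nonneg _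
  have hsq : c₀ ^ 2 ≤ sInf S ^ 2 := pow_le_pow_left₀ hc₀nn hle 2
  rw [hc₀, Real.sq_sqrt (by positivity), div_le_iff₀ hpos] at hsq
  rw [hdef]
  linarith

/-- **Discharge of LLL82 Prop. 1.11** (`norm_zero_sq_le_two_pow_mul_minNorm_sq`): for an
LLL-reduced (`δ = 3/4`) basis `b₀, …, bₙ₋₁` (`n ≥ 1`) of `E` and `L = ∑ ℤ bₖ`,
`‖b₀‖² ≤ 2^{n-1} λ₁(L)²`, where `λ₁(L) = minNorm L`; from Prop. 1.12 with `i = j = 0` and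
`λ₁ = minNorm` (`successiveMinimum_one_eq_minNorm_holds`). Ref: LLL82, Prop. 1.11; Cohen,
GTM 138, Thm. 2.6.2 (4); Lenstra, *Lattices*, §10 (`q(b₁) ≤ c^{n-1} λ(L)`).
[cite: LenstraLenstraLovasz1982, Prop. 1.11] -/
theorem norm_zero_sq_le_two_pow_mul_minNorm_sq_holds :
    norm_zero_sq_le_two_pow_mul_minNorm_sq (E := E) (n := n) := by
  intro b h hn
  haveI : FiniteDimensional ℝ E := Module.Finite.of_basis b
  have h12 := norm_sq_le_two_pow_mul_successiveMinimum_sq_holds b h ⟨0, Nat.pos_of_ne_zero hn⟩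
    ⟨0, Nat.pos_of_ne_zero hn⟩ le_rfl
  have h1 : successiveMinimum (Literature.Computability.Cryptography.latticeOfBasis b) 1 = minNorm (Literature.Computability.Cryptography.latticeOfBasis b) :=
    successiveMinimum_one_eq_minNorm_holds (E := E) _
  simpa [h1] using h12

end Literature.Algebra.EuclideanLattices.IsLLLReduced

/-! ### LLL82 Prop. 1.6 (1.8)–(1.9): the volume formula and the covolume form of the LLL bound -/

namespace Literature.Algebra.EuclideanLattices

open MeasureTheory

variable {E : Type*} [NormedAddCommGroup E] [InnerProductSpace ℝ E] [FiniteDimensional ℝ E]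
  [MeasurableSpace E] [BorelSpace E] {n : ℕ}

/-- **Volume formula.** The determinant of the lattice spanned by a basis `b` of a Euclidean
space equals the product of the norms of the Gram–Schmidt vectors: `d(L(b)) = ∏ᵢ ‖b*ᵢ‖`, for
`d = ZLattice.covolume` with respect to the canonical volume of the inner product space (an
orthonormal parallelepiped has measure `1`). Printed form: `d(L) = det(Q)^{1/2} = |det B|` for the
Gram matrix `Q = (bᵢ ⋅ bⱼ) = Bᵗ B`, `B` the coordinates of `b` on an orthonormal basis (Cohen, GTM
138, §2.5.1, p. 127), and "`d(L)² = ∏_{1≤i≤n} ‖b*ᵢ‖²`" (Prop. 2.5.4, p. 129); LLL82 uses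
`d(L) = ∏ ‖b*ᵢ‖` inside the proof of (1.8). Proof here: change of basis to the
orthonormal basis `gramSchmidtOrthonormalBasis` (`ZSpan.measureReal_fundamentalDomain`,
`OrthonormalBasis.volume_parallelepiped`), whose transition determinant is `∏ᵢ ⟪eᵢ, bᵢ⟫ = ∏ᵢ ‖b*ᵢ‖`
(`gramSchmidtOrthonormalBasis_det`). [cite: Cohen1993, Prop. 2.5.4 pp. 128–129] -/
theorem covolume_latticeOfBasis_eq_prod_norm_gramSchmidt (b : Basis (Fin n) ℝ E) :
    ZLattice.covolume (Literature.Computability.Cryptography.latticeOfBasis b) = ∏ i, ‖gramSchmidt ℝ (⇑b) i‖ := by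
  classical
  have hn : finrank ℝ E = Fintype.card (Fin n) := by rw [finrank_eq_card_basis b]
  have hli : LinearIndependent ℝ (⇑b) := b.linearIndependent
  set e := gramSchmidtOrthonormalBasis hn (⇑b) with he
  have h1 : ZLattice.covolume (Literature.Computability.Cryptography.latticeOfBasis b) =
      |e.toBasis.det (⇑b)| * volume.real (ZSpan.fundamentalDomain e.toBasis) := by
    rw [ZLattice.covolume_eq_measure_fundamentalDomain _ _ (ZSpan.isAddFundamentalDomain b volume)]
    exact ZSpan.measureReal_fundamentalDomain b volume e.toBasis
  have h2 : volume.real (ZSpan.fundamentalDomain e.toBasis) = 1 := by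
    rw [measureReal_congr (ZSpan.fundamentalDomain_ae_parallelepiped e.toBasis volume),
      measureReal_def, OrthonormalBasis.coe_toBasis, e.volume_parallelepiped, ENNReal.toReal_one]
  have h3 : ∀ i, ⟪e i, b i⟫_ℝ = ‖gramSchmidt ℝ (⇑b) i‖ := by
    intro i
    have hne : gramSchmidt ℝ (⇑b) i ≠ 0 := gramSchmidt_ne_zero i hli
    have hne' : gramSchmidtNormed ℝ (⇑b) i ≠ 0 := by
      intro h0
      have := gramSchmidtNormed_unit_length i hli
      rw [h0, norm_zero] at this
      exact zero_ne_one this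
    rw [he, gramSchmidtOrthonormalBasis_apply hn hne', gramSchmidtNormed, real_inner_smul_left,
      real_inner_comm, Literature.Algebra.EuclideanLattices.inner_self_gramSchmidt]
    simp only [RCLike.ofReal_real_eq_id, id_eq]
    rw [sq, ← mul_assoc, inv_mul_cancel₀ (norm_ne_zero_iff.2 hne), one_mul]
  rw [h1, h2, mul_one, gramSchmidtOrthonormalBasis_det hn (⇑b), Finset.abs_prod]
  exact Finset.prod_congr rfl fun i _ => by rw [h3 i, abs_of_nonneg (norm_nonneg _)]

end Literature.Algebra.EuclideanLattices

namespace Literature.Algebra.EuclideanLattices.IsLLLReduced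

open MeasureTheory

variable {E : Type*} [NormedAddCommGroup E] [InnerProductSpace ℝ E] [FiniteDimensional ℝ E]
  [MeasurableSpace E] [BorelSpace E] {n : ℕ}

/-- **Discharge of LLL82 Prop. 1.6 (1.8)** (`prod_norm_le`): for an LLL-reduced (`δ = 3/4`) basis
`b₀, …, bₙ₋₁` of `E` and `L = ∑ ℤ bᵢ`, `∏ᵢ ‖bᵢ‖ ≤ 2^{n(n-1)/4} d(L)`: the Gram–Schmidt form
`∏ ‖bᵢ‖ ≤ 2^{n(n-1)/4} ∏ ‖b*ᵢ‖` (`prod_norm_le_two_pow_mul_prod_norm_gramSchmidt_holds`) combined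
with `d(L) = ∏ᵢ ‖b*ᵢ‖` (`Literature.Algebra.EuclideanLattices.covolume_latticeOfBasis_eq_prod_norm_gramSchmidt`).
Ref: LLL82, Prop. 1.6 (1.8) and its proof; Cohen, GTM 138, Thm. 2.6.2 (1) and proof, p. 132.
[cite: LenstraLenstraLovasz1982, Prop. 1.6 (1.8)] -/
theorem prod_norm_le_holds : prod_norm_le (E := E) (n := n) := by
  intro b h
  rw [Literature.Algebra.EuclideanLattices.covolume_latticeOfBasis_eq_prod_norm_gramSchmidt]
  exact prod_norm_le_two_pow_mul_prod_norm_gramSchmidt_holds h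

/-- **Discharge of LLL82 Prop. 1.6 (1.9)** (`norm_zero_le_covolume_rpow`): for an LLL-reduced
(`δ = 3/4`) basis `b₀, …, bₙ₋₁` (`n ≥ 1`) of `E` and `L = ∑ ℤ bᵢ`, `‖b₀‖ ≤ 2^{(n-1)/4} d(L)^{1/n}`.
As printed: from `‖b₀‖² ≤ 2^i ‖b*ᵢ‖²` for every `i` (`sq_norm_zero_le_two_pow_mul_holds`, the case
`j = 0` of (1.7)), the product over `i` gives
`‖b₀‖^{2n} ≤ 2^{n(n-1)/2} ∏ ‖b*ᵢ‖² = 2^{n(n-1)/2} d(L)²`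
(`Literature.Algebra.EuclideanLattices.covolume_latticeOfBasis_eq_prod_norm_gramSchmidt`), and `2n`-th roots are monotone.
Ref: LLL82, Prop. 1.6 (1.9) and its proof; Cohen, GTM 138, Thm. 2.6.2 (3) and proof, p. 132.
[cite: LenstraLenstraLovasz1982, Prop. 1.6 (1.9)] -/
theorem norm_zero_le_covolume_rpow_holds : norm_zero_le_covolume_rpow (E := E) (n := n) := by
  intro b h hn
  rw [Literature.Algebra.EuclideanLattices.covolume_latticeOfBasis_eq_prod_norm_gramSchmidt]
  set d : ℝ := ∏ i, ‖gramSchmidt ℝ (⇑b) i‖ with hd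
  have hd0 : 0 ≤ d := Finset.prod_nonneg fun i _ => norm_nonneg _
  have hR : 0 ≤ (2 : ℝ) ^ (((n : ℝ) - 1) / 4) * d ^ (1 / (n : ℝ)) :=
    mul_nonneg (Real.rpow_nonneg zero_le_two _) (Real.rpow_nonneg hd0 _)
  rw [← pow_le_pow_iff_left₀ (norm_nonneg _) hR (by positivity : 2 * n ≠ 0)]
  have hL : ‖b ⟨0, Nat.pos_of_ne_zero hn⟩‖ ^ (2 * n) =
      ∏ _i : Fin n, ‖b ⟨0, Nat.pos_of_ne_zero hn⟩‖ ^ 2 := by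
    rw [Finset.prod_const, Finset.card_univ, Fintype.card_fin, pow_mul]
  have hg : ∀ m : ℕ, ∑ k ∈ Finset.range m, (k : ℝ) = m * (m - 1) / 2 := by
    intro m
    induction m with
    | zero => simp
    | succ m ih => rw [Finset.sum_range_succ, ih]; push_cast; ring
  have hsum : ((∑ i : Fin n, (i : ℕ) : ℕ) : ℝ) = (n : ℝ) * (n - 1) / 2 := by
    push_cast
    rw [Fin.sum_univ_eq_sum_range (fun k => (k : ℝ)) n, hg]
  have key : ((2 : ℝ) ^ (((n : ℝ) - 1) / 4) * d ^ (1 / (n : ℝ))) ^ (2 * n) =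
      ∏ i : Fin n, (2 : ℝ) ^ (i : ℕ) * ‖gramSchmidt ℝ (⇑b) i‖ ^ 2 := by
    have hn' : (n : ℝ) ≠ 0 := Nat.cast_ne_zero.2 hn
    have e1 : ((2 : ℝ) ^ (((n : ℝ) - 1) / 4)) ^ (2 * n) = ∏ i : Fin n, (2 : ℝ) ^ (i : ℕ) := by
      rw [← Real.rpow_mul_natCast zero_le_two, Finset.prod_pow_eq_pow_sum,
        ← Real.rpow_natCast _ (∑ i : Fin n, (i : ℕ)), hsum]
      congr 1
      push_cast
      field_simp
      ring
    have e2 : (d ^ (1 / (n : ℝ))) ^ (2 * n) = ∏ i, ‖gramSchmidt ℝ (⇑b) i‖ ^ 2 := by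
      rw [← Real.rpow_mul_natCast hd0, Finset.prod_pow,
        show 1 / (n : ℝ) * ((2 * n : ℕ) : ℝ) = ((2 : ℕ) : ℝ) by push_cast; field_simp]
      exact Real.rpow_natCast d 2
    rw [mul_pow, e1, e2, ← Finset.prod_mul_distrib]
  rw [hL, key]
  exact Finset.prod_le_prod (fun i _ => sq_nonneg _) fun i _ =>
    sq_norm_zero_le_two_pow_mul_holds h i (Nat.pos_of_ne_zero hn)

end Literature.Algebra.EuclideanLattices.IsLLLReduced
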